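import Mathlib
import Summits.PneNP.PneNP.Theorems.OverlapGapAlgebraSearchHardWindowSequentialLocalPostProcMS

/-!
# PneNP / OverlapGapAlgebra — `SearchHardWindow`:
# sequential local decimation followed by LOCAL POST-PROCESSING (3/3) — the rung

Support for crux `stmt-PneNP-2460` (`Summit.PneNP.PneNP.Theses.OverlapGapAlgebra.SearchHardWindow`).
Consequences of `shwSeqP_meanSquare` (an index-order decimation rule with unit look-ahead `g₀`
followed by ANY radius-`r` local post-processing `g` of `(Φ, g₀ Φ)` is ℓ²-stable at the
polylogarithmic scale `s₂(n) = 8k²P + 2(k+1)²PK + 1`, `P = (3k log n + k + 1)^{2r}`) through the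
mean-square rate `shwMSR_successCount_le_rate` (resting on the proved crux `NoStableSection`):

* `shwSeqP_isLittleO` — the scale is admissible for every constant `r`;
* `shwSeqP_postMapsFail_rate` — UNCONDITIONALLY, for `k ≥ k₀` and every `r` there is `C` with:
  eventually in `n`, every such post-processed sequential local map solves at most a
  `C log^{2r+2} n / n` fraction of `F_k(n, ⌊α_k n⌋)`, `α_k = 5·2^k log k / k` — decimation in a fixed
  order followed by `r` rounds of parallel local repair / message-passing re-estimation / bounded-range
  deterministic local search fails in the Bresler–Huang window;
* `shwSeqP_postMapsFail` — the same at every constant level `ε`;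
* `shwSeqP_hardnessConjunct_window` — the hardness conjunct of `SearchHardWindow`, verbatim shape, for
  ANY `f : List Bool → List Bool` whose decoded assignment is, eventually in `n`, a radius-`r` local
  function of `(Φ, g₀ Φ)` for some index-order decimation rule with unit look-ahead `g₀`.
No definitions; axioms `propext`, `Classical.choice`, `Quot.sound`.
-/

set_option linter.dupNamespace false -- `Summit.PneNP.PneNP.…`: summit = sub-problem (D-0017)

namespace Summit.PneNP.PneNP.Theorems

open Finset Filter Asymptotics
open scoped Classical

section SeqPostRung

/-- Polynomial-in-`log` bound for the scale: for `log n ≥ 1` and `K ≥ 0`,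
`1 + log² n · (8k²P + 2(k+1)²PK + 1) ≤ ((8k² + 2(k+1)²K)(4k+1)^{2r} + 2) · log^{2r+2} n`. -/
theorem shwSeqP_scale_le (k r : ℕ) (K L : ℝ) (hK : 0 ≤ K) (hL1 : 1 ≤ L) :
    1 + L ^ 2 * (8 * (k : ℝ) ^ 2 * (3 * k * L + k + 1) ^ (2 * r) +
        2 * ((k : ℝ) + 1) ^ 2 * (3 * k * L + k + 1) ^ (2 * r) * K + 1) ≤
      ((8 * (k : ℝ) ^ 2 + 2 * ((k : ℝ) + 1) ^ 2 * K) * (4 * k + 1) ^ (2 * r) + 2) * L ^ (2 * r + 2) := by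
  have hk0 : (0 : ℝ) ≤ k := Nat.cast_nonneg _
  have hL0 : 0 ≤ L := by linarith
  have hbase0 : 0 ≤ 3 * k * L + k + 1 := by positivity
  have hbase : 3 * k * L + k + 1 ≤ (4 * k + 1) * L := by nlinarith
  have hpow : (3 * k * L + k + 1) ^ (2 * r) ≤ (4 * k + 1) ^ (2 * r) * L ^ (2 * r) := by
    rw [← mul_pow]; exact pow_le_pow_left₀ hbase0 hbase _
  have hL2 : 0 ≤ L ^ 2 := by positivity
  have hLbig : 1 ≤ L ^ (2 * r + 2) := one_le_pow₀ hL1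
  have hL2le : L ^ 2 ≤ L ^ (2 * r + 2) := pow_le_pow_right₀ hL1 (by omega)
  have hA0 : 0 ≤ 8 * (k : ℝ) ^ 2 + 2 * ((k : ℝ) + 1) ^ 2 * K := by positivity
  have h1 : 8 * (k : ℝ) ^ 2 * (3 * k * L + k + 1) ^ (2 * r) +
      2 * ((k : ℝ) + 1) ^ 2 * (3 * k * L + k + 1) ^ (2 * r) * K + 1 ≤
      (8 * (k : ℝ) ^ 2 + 2 * ((k : ℝ) + 1) ^ 2 * K) * ((4 * k + 1) ^ (2 * r) * L ^ (2 * r)) + 1 := by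
    have := mul_le_mul_of_nonneg_left hpow hA0
    nlinarith
  have h2 : L ^ 2 * ((8 * (k : ℝ) ^ 2 + 2 * ((k : ℝ) + 1) ^ 2 * K) * ((4 * k + 1) ^ (2 * r) * L ^ (2 * r)) + 1)
      = (8 * (k : ℝ) ^ 2 + 2 * ((k : ℝ) + 1) ^ 2 * K) * (4 * k + 1) ^ (2 * r) * L ^ (2 * r + 2) + L ^ 2 := by
    ring
  calc 1 + L ^ 2 * (8 * (k : ℝ) ^ 2 * (3 * k * L + k + 1) ^ (2 * r) +
        2 * ((k : ℝ) + 1) ^ 2 * (3 * k * L + k + 1) ^ (2 * r) * K + 1)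
      ≤ 1 + L ^ 2 * ((8 * (k : ℝ) ^ 2 + 2 * ((k : ℝ) + 1) ^ 2 * K) * ((4 * k + 1) ^ (2 * r) * L ^ (2 * r)) + 1) := by
        linarith [mul_le_mul_of_nonneg_left h1 hL2]
    _ = 1 + ((8 * (k : ℝ) ^ 2 + 2 * ((k : ℝ) + 1) ^ 2 * K) * (4 * k + 1) ^ (2 * r) * L ^ (2 * r + 2) + L ^ 2) := by
        rw [h2]
    _ ≤ ((8 * (k : ℝ) ^ 2 + 2 * ((k : ℝ) + 1) ^ 2 * K) * (4 * k + 1) ^ (2 * r) + 2) * L ^ (2 * r + 2) := by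
        nlinarith

/-- The scale is admissible: `(8k²P + 2(k+1)²PK + 1) log³ n = o(n)`, `P = (3k log n + k + 1)^{2r}`. -/
theorem shwSeqP_isLittleO (k r : ℕ) (K : ℝ) (hK : 0 ≤ K) :
    (fun n : ℕ => (8 * (k : ℝ) ^ 2 * (3 * k * Real.log n + k + 1) ^ (2 * r) +
        2 * ((k : ℝ) + 1) ^ 2 * (3 * k * Real.log n + k + 1) ^ (2 * r) * K + 1) * Real.log n ^ 3)
      =o[atTop] (fun n : ℕ => (n : ℝ)) := by
  have h1 : (fun n : ℕ => Real.log n ^ (2 * r + 5)) =o[atTop] (fun n : ℕ => (n : ℝ)) := by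
    have := (Real.isLittleO_pow_log_id_atTop (n := 2 * r + 5)).comp_tendsto tendsto_natCast_atTop_atTop
    simpa [Function.comp_def] using this
  set C : ℝ := (8 * (k : ℝ) ^ 2 + 2 * ((k : ℝ) + 1) ^ 2 * K) * (4 * k + 1) ^ (2 * r) + 2 with hC
  have h2 : (fun n : ℕ => (8 * (k : ℝ) ^ 2 * (3 * k * Real.log n + k + 1) ^ (2 * r) +
        2 * ((k : ℝ) + 1) ^ 2 * (3 * k * Real.log n + k + 1) ^ (2 * r) * K + 1) * Real.log n ^ 3)
      =O[atTop] (fun n : ℕ => Real.log n ^ (2 * r + 5)) := by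
    refine IsBigO.of_bound C ?_
    filter_upwards [eventually_ge_atTop 3] with n hn
    have hn3 : (3 : ℝ) ≤ n := by exact_mod_cast hn
    have hL1 : 1 ≤ Real.log n := by
      rw [← Real.log_exp 1]
      apply Real.log_le_log (Real.exp_pos 1)
      have : Real.exp 1 ≤ 3 := le_of_lt (lt_trans Real.exp_one_lt_d9 (by norm_num))
      exact this.trans hn3
    set L := Real.log n with hL
    have hL0 : 0 ≤ L := by linarith
    have hk0 : (0 : ℝ) ≤ k := Nat.cast_nonneg _
    have hS0 : 0 ≤ 8 * (k : ℝ) ^ 2 * (3 * k * L + k + 1) ^ (2 * r) +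
        2 * ((k : ℝ) + 1) ^ 2 * (3 * k * L + k + 1) ^ (2 * r) * K + 1 := by positivity
    have hsc := shwSeqP_scale_le k r K L hK hL1
    -- `S L³ ≤ (1 + L² S) L³ ≤ C L^{2r+2} L³ = C L^{2r+5}`
    have hval : (8 * (k : ℝ) ^ 2 * (3 * k * L + k + 1) ^ (2 * r) +
        2 * ((k : ℝ) + 1) ^ 2 * (3 * k * L + k + 1) ^ (2 * r) * K + 1) * L ^ 3 ≤ C * L ^ (2 * r + 5) := by
      have hL3 : 0 ≤ L ^ 3 := by positivity
      have hL2 : 1 ≤ L ^ 2 := one_le_pow₀ hL1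
      have hstep : (8 * (k : ℝ) ^ 2 * (3 * k * L + k + 1) ^ (2 * r) +
          2 * ((k : ℝ) + 1) ^ 2 * (3 * k * L + k + 1) ^ (2 * r) * K + 1) ≤ C * L ^ (2 * r + 2) := by
        rw [hC]; nlinarith
      calc _ ≤ C * L ^ (2 * r + 2) * L ^ 3 := mul_le_mul_of_nonneg_right hstep hL3
        _ = C * L ^ (2 * r + 5) := by ring
    rw [Real.norm_eq_abs, Real.norm_eq_abs, abs_of_nonneg (by positivity), abs_of_nonneg (by positivity)]
    exact hval
  exact h2.trans_isLittleO h1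

/-- **Post-processed sequential local maps fail in the Bresler–Huang window, with a polynomial rate
(unconditional).** For all `k ≥ k₀` and every `r` there is `C > 0` such that, eventually in `n`, for
every index-order decimation rule with unit look-ahead `g₀` and every radius-`r` local function `g` of
`(Φ, g₀ Φ)` on `F_k(n, ⌊α_k n⌋)`, `g` solves at most a `C log^{2r+2} n / n` fraction of the instances. -/
theorem shwSeqP_postMapsFail_rate :
    ∃ k₀ : ℕ, ∀ k : ℕ, k₀ ≤ k → ∀ r : ℕ, ∃ C : ℝ, 0 < C ∧
      ∀ᶠ n : ℕ in atTop, ∀ m : ℕ, m = ⌊5 * 2 ^ k * Real.log k / k * n⌋₊ →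
        ∀ g₀ g : (Fin m → Fin k → Fin n × Bool) → (Fin n → Bool), (∀ (Φ Φ' : (Fin m → Fin k → Fin n × Bool)) (v : Fin n),
        (∀ i : Fin m, ((∃ j : Fin k, (Φ i j).1 = v) ∨ (∃ j : Fin k, (Φ' i j).1 = v)) → Φ i = Φ' i) →
        (∀ (i : Fin m) (j j' : Fin k), (Φ i j).1 = v → (Φ i j').1 < v →
          g₀ Φ (Φ i j').1 = g₀ Φ' (Φ i j').1) →
        g₀ Φ v = g₀ Φ' v) → (∀ (Φ Φ' : (Fin m → Fin k → Fin n × Bool)) (v : Fin n),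
        (∀ i : Fin m, ((∃ j : Fin k, ∃ pw : ℕ → Fin n, pw 0 = v ∧ pw r = (Φ i j).1 ∧
          (∀ s, s < r → (pw s = pw (s + 1) ∨
            ∃ i' : Fin m, ∃ j₁ j₂ : Fin k, (Φ i' j₁).1 = pw s ∧ (Φ i' j₂).1 = pw (s + 1)))) ∨
         (∃ j : Fin k, ∃ pw : ℕ → Fin n, pw 0 = v ∧ pw r = (Φ' i j).1 ∧
          (∀ s, s < r → (pw s = pw (s + 1) ∨
            ∃ i' : Fin m, ∃ j₁ j₂ : Fin k, (Φ' i' j₁).1 = pw s ∧ (Φ' i' j₂).1 = pw (s + 1))))) → Φ i = Φ' i) →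
        (∀ u : Fin n, (∃ pw : ℕ → Fin n, pw 0 = v ∧ pw r = u ∧
          (∀ s, s < r → (pw s = pw (s + 1) ∨
            ∃ i' : Fin m, ∃ j₁ j₂ : Fin k, (Φ i' j₁).1 = pw s ∧ (Φ i' j₂).1 = pw (s + 1)))) → g₀ Φ u = g₀ Φ' u) →
        g Φ v = g Φ' v) →
          ((Finset.univ.filter fun Φ : Fin m → Fin k → Fin n × Bool =>
              ∀ i, ∃ j, g Φ (Φ i j).1 = (Φ i j).2).card : ℝ)
            ≤ C * Real.log n ^ (2 * r + 2) / n * Fintype.card (Fin m → Fin k → Fin n × Bool) := by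
  obtain ⟨k₀, h⟩ := shwMSR_successCount_le_rate
  refine ⟨k₀, fun k hk r => ?_⟩
  obtain ⟨C₀, hC₀, hmain⟩ := h k hk
  have hk0 : (0 : ℝ) ≤ k := Nat.cast_nonneg _
  set α : ℝ := 5 * 2 ^ k * Real.log k / k with hαdef
  have hα : 0 ≤ α := by
    rw [hαdef]
    exact div_nonneg (mul_nonneg (by positivity) (Real.log_natCast_nonneg k)) (Nat.cast_nonneg k)
  set Kx : ℝ := (1 + α * (k : ℝ) ^ 2) * Real.exp (α * (k : ℝ) ^ 2 * (1 + (k : ℝ) ^ 2 + α * (k : ℝ) ^ 2))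
    with hKx
  have hKx0 : 0 ≤ Kx := by rw [hKx]; positivity
  set Cc : ℝ := (8 * (k : ℝ) ^ 2 + 2 * ((k : ℝ) + 1) ^ 2 * Kx) * (4 * k + 1) ^ (2 * r) + 2 with hCc
  have hCcpos : 0 < Cc := by rw [hCc]; positivity
  refine ⟨C₀ * Cc, mul_pos hC₀ hCcpos, ?_⟩
  have hev := hmain (fun n : ℕ => 8 * (k : ℝ) ^ 2 * (3 * k * Real.log n + k + 1) ^ (2 * r) +
      2 * ((k : ℝ) + 1) ^ 2 * (3 * k * Real.log n + k + 1) ^ (2 * r) * Kx + 1) (shwSeqP_isLittleO k r Kx hKx0)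
  have hlargeE : ∀ᶠ n : ℕ in atTop, Real.exp (α * k * Real.exp 2) ≤ (n : ℝ) ^ 3 :=
    ((tendsto_pow_atTop (by norm_num : (3 : ℕ) ≠ 0)).comp tendsto_natCast_atTop_atTop).eventually_ge_atTop _
  filter_upwards [hev, hlargeE, eventually_ge_atTop 3] with n hn hlarge hn3 m hm g₀ g hseq hpost
  have hn1 : 1 ≤ n := le_trans (by norm_num) hn3
  have hn3R : (3 : ℝ) ≤ n := by exact_mod_cast hn3
  have hnpos : (0 : ℝ) < n := by linarith only [hn3R]
  have hm_le : (m : ℝ) ≤ α * n := by rw [hm]; exact Nat.floor_le (by positivity)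
  have hS := shwSeqP_meanSquare r hn1 α hα hm_le hlarge g₀ g hseq hpost
  have hlog0 : 0 ≤ Real.log n := Real.log_nonneg (by linarith)
  have hs0 : (0 : ℝ) ≤ 8 * (k : ℝ) ^ 2 * (3 * k * Real.log n + k + 1) ^ (2 * r) +
      2 * ((k : ℝ) + 1) ^ 2 * (3 * k * Real.log n + k + 1) ^ (2 * r) * Kx + 1 := by positivity
  have hle := hn m hm g hs0 hS
  have hL1 : 1 ≤ Real.log n := by
    rw [← Real.log_exp 1]
    apply Real.log_le_log (Real.exp_pos 1)
    have : Real.exp 1 ≤ 3 := le_of_lt (lt_trans Real.exp_one_lt_d9 (by norm_num))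
    exact this.trans hn3R
  have hpoly := shwSeqP_scale_le k r Kx (Real.log n) hKx0 hL1
  have hNnn : (0 : ℝ) ≤ Fintype.card (Fin m → Fin k → Fin n × Bool) := Nat.cast_nonneg _
  calc ((Finset.univ.filter fun Φ : Fin m → Fin k → Fin n × Bool =>
        ∀ i, ∃ j, g Φ (Φ i j).1 = (Φ i j).2).card : ℝ)
      ≤ C₀ * (1 + Real.log n ^ 2 * (8 * (k : ℝ) ^ 2 * (3 * k * Real.log n + k + 1) ^ (2 * r) +
          2 * ((k : ℝ) + 1) ^ 2 * (3 * k * Real.log n + k + 1) ^ (2 * r) * Kx + 1)) / n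
          * Fintype.card (Fin m → Fin k → Fin n × Bool) := hle
    _ ≤ C₀ * (Cc * Real.log n ^ (2 * r + 2)) / n * Fintype.card (Fin m → Fin k → Fin n × Bool) := by
        apply mul_le_mul_of_nonneg_right _ hNnn
        apply div_le_div_of_nonneg_right _ hnpos.le
        exact mul_le_mul_of_nonneg_left hpoly hC₀.le
    _ = C₀ * Cc * Real.log n ^ (2 * r + 2) / n * Fintype.card (Fin m → Fin k → Fin n × Bool) := by ring

/-- **Post-processed sequential local maps fail in the window at every constant success level
(unconditional).** -/
theorem shwSeqP_postMapsFail :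
    ∃ k₀ : ℕ, ∀ k : ℕ, k₀ ≤ k → ∀ (r : ℕ) (ε : ℝ), 0 < ε →
      ∀ᶠ n : ℕ in atTop, ∀ m : ℕ, m = ⌊5 * 2 ^ k * Real.log k / k * n⌋₊ →
        ∀ g₀ g : (Fin m → Fin k → Fin n × Bool) → (Fin n → Bool), (∀ (Φ Φ' : (Fin m → Fin k → Fin n × Bool)) (v : Fin n),
        (∀ i : Fin m, ((∃ j : Fin k, (Φ i j).1 = v) ∨ (∃ j : Fin k, (Φ' i j).1 = v)) → Φ i = Φ' i) →
        (∀ (i : Fin m) (j j' : Fin k), (Φ i j).1 = v → (Φ i j').1 < v →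
          g₀ Φ (Φ i j').1 = g₀ Φ' (Φ i j').1) →
        g₀ Φ v = g₀ Φ' v) → (∀ (Φ Φ' : (Fin m → Fin k → Fin n × Bool)) (v : Fin n),
        (∀ i : Fin m, ((∃ j : Fin k, ∃ pw : ℕ → Fin n, pw 0 = v ∧ pw r = (Φ i j).1 ∧
          (∀ s, s < r → (pw s = pw (s + 1) ∨
            ∃ i' : Fin m, ∃ j₁ j₂ : Fin k, (Φ i' j₁).1 = pw s ∧ (Φ i' j₂).1 = pw (s + 1)))) ∨
         (∃ j : Fin k, ∃ pw : ℕ → Fin n, pw 0 = v ∧ pw r = (Φ' i j).1 ∧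
          (∀ s, s < r → (pw s = pw (s + 1) ∨
            ∃ i' : Fin m, ∃ j₁ j₂ : Fin k, (Φ' i' j₁).1 = pw s ∧ (Φ' i' j₂).1 = pw (s + 1))))) → Φ i = Φ' i) →
        (∀ u : Fin n, (∃ pw : ℕ → Fin n, pw 0 = v ∧ pw r = u ∧
          (∀ s, s < r → (pw s = pw (s + 1) ∨
            ∃ i' : Fin m, ∃ j₁ j₂ : Fin k, (Φ i' j₁).1 = pw s ∧ (Φ i' j₂).1 = pw (s + 1)))) → g₀ Φ u = g₀ Φ' u) →
        g Φ v = g Φ' v) →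
          ((Finset.univ.filter fun Φ : Fin m → Fin k → Fin n × Bool =>
              ∀ i, ∃ j, g Φ (Φ i j).1 = (Φ i j).2).card : ℝ)
            ≤ ε * Fintype.card (Fin m → Fin k → Fin n × Bool) := by
  obtain ⟨k₀, h⟩ := shwSeqP_postMapsFail_rate
  refine ⟨k₀, fun k hk r ε hε => ?_⟩
  obtain ⟨C, hC, hrate⟩ := h k hk r
  have hlog : (fun n : ℕ => Real.log n ^ (2 * r + 2)) =o[atTop] (fun n : ℕ => (n : ℝ)) := by
    have := (Real.isLittleO_pow_log_id_atTop (n := 2 * r + 2)).comp_tendsto tendsto_natCast_atTop_atTop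
    simpa [Function.comp_def] using this
  have hsmall := hlog.def (div_pos hε hC)
  filter_upwards [hrate, hsmall, eventually_ge_atTop 1] with n hn hsm hn1 m hm g₀ g hseq hpost
  have hnpos : (0 : ℝ) < n := by exact_mod_cast hn1
  have hNnn : (0 : ℝ) ≤ Fintype.card (Fin m → Fin k → Fin n × Bool) := Nat.cast_nonneg _
  refine (hn m hm g₀ g hseq hpost).trans (mul_le_mul_of_nonneg_right ?_ hNnn)
  rw [Real.norm_eq_abs, Real.norm_eq_abs, abs_of_nonneg (by positivity),
    abs_of_nonneg hnpos.le] at hsm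
  rw [div_le_iff₀ hnpos]
  calc C * Real.log n ^ (2 * r + 2) ≤ C * (ε / C * n) := mul_le_mul_of_nonneg_left hsm hC.le
    _ = ε * n := by field_simp

end SeqPostRung

section SeqPostWindow

/-- **The post-processed sequential local rung for the crux's hardness conjunct (verbatim shape, in
the window).** For all `k ≥ k₀`, every `r` and ANY `f : List Bool → List Bool` (no complexity
hypothesis) whose decoded assignment on `F_k(n, ⌊α_k n⌋)` is, eventually in `n`, a radius-`r` local
function of `(Φ, g₀ Φ)` for some index-order decimation rule with unit look-ahead `g₀`, the success
ratio of `f` is eventually `≤ ε`, for every `ε > 0`. -/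
theorem shwSeqP_hardnessConjunct_window :
    ∃ k₀ : ℕ, ∀ k : ℕ, k₀ ≤ k → ∀ (r : ℕ) (f : List Bool → List Bool),
      (∀ᶠ n : ℕ in atTop, ∀ m : ℕ, m = ⌊5 * 2 ^ k * Real.log k / k * n⌋₊ →
        ∃ g₀ : (Fin m → Fin k → Fin n × Bool) → (Fin n → Bool), (∀ (Φ Φ' : (Fin m → Fin k → Fin n × Bool)) (v : Fin n),
        (∀ i : Fin m, ((∃ j : Fin k, (Φ i j).1 = v) ∨ (∃ j : Fin k, (Φ' i j).1 = v)) → Φ i = Φ' i) →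
        (∀ (i : Fin m) (j j' : Fin k), (Φ i j).1 = v → (Φ i j').1 < v →
          g₀ Φ (Φ i j').1 = g₀ Φ' (Φ i j').1) →
        g₀ Φ v = g₀ Φ' v) ∧
          (∀ (Φ Φ' : (Fin m → Fin k → Fin n × Bool)) (v : Fin n),
        (∀ i : Fin m, ((∃ j : Fin k, ∃ pw : ℕ → Fin n, pw 0 = v ∧ pw r = (Φ i j).1 ∧
          (∀ s, s < r → (pw s = pw (s + 1) ∨
            ∃ i' : Fin m, ∃ j₁ j₂ : Fin k, (Φ i' j₁).1 = pw s ∧ (Φ i' j₂).1 = pw (s + 1)))) ∨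
         (∃ j : Fin k, ∃ pw : ℕ → Fin n, pw 0 = v ∧ pw r = (Φ' i j).1 ∧
          (∀ s, s < r → (pw s = pw (s + 1) ∨
            ∃ i' : Fin m, ∃ j₁ j₂ : Fin k, (Φ' i' j₁).1 = pw s ∧ (Φ' i' j₂).1 = pw (s + 1))))) → Φ i = Φ' i) →
        (∀ u : Fin n, (∃ pw : ℕ → Fin n, pw 0 = v ∧ pw r = u ∧
          (∀ s, s < r → (pw s = pw (s + 1) ∨
            ∃ i' : Fin m, ∃ j₁ j₂ : Fin k, (Φ i' j₁).1 = pw s ∧ (Φ i' j₂).1 = pw (s + 1)))) → g₀ Φ u = g₀ Φ' u) →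
        (f (Literature.Computability.Complexity.encodingCNF.encode (List.ofFn fun a =>
            List.ofFn fun b => (((Φ a b).1 : ℕ), (Φ a b).2)))).getD v false =
        (f (Literature.Computability.Complexity.encodingCNF.encode (List.ofFn fun a =>
            List.ofFn fun b => (((Φ' a b).1 : ℕ), (Φ' a b).2)))).getD v false)) →
      ∀ ε : ℝ, 0 < ε → ∀ᶠ n : ℕ in Filter.atTop, ∀ m : ℕ, m = ⌊5 * 2 ^ k * Real.log k / k * n⌋₊ →
        ((Finset.univ.filter fun Φ : Fin m → Fin k → Fin n × Bool => ∀ i, ∃ j,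
            (f (Literature.Computability.Complexity.encodingCNF.encode (List.ofFn fun a =>
            List.ofFn fun b => (((Φ a b).1 : ℕ), (Φ a b).2)))).getD (Φ i j).1 false = (Φ i j).2).card : ℝ) / Fintype.card (Fin m → Fin k → Fin n × Bool) ≤ ε := by
  obtain ⟨k₀, h⟩ := shwSeqP_postMapsFail
  refine ⟨k₀, fun k hk r f hf ε hε => ?_⟩
  filter_upwards [h k hk r ε hε, hf, eventually_ge_atTop 1] with n hn hfn hn1
  intro m hm
  have hpos : (0 : ℝ) < Fintype.card (Fin m → Fin k → Fin n × Bool) := by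
    have : 0 < n := hn1
    have : Nonempty (Fin n) := ⟨⟨0, this⟩⟩
    exact_mod_cast Fintype.card_pos
  obtain ⟨g₀, hseq, hpost⟩ := hfn m hm
  have key := hn m hm g₀ (fun Φ v => (f (Literature.Computability.Complexity.encodingCNF.encode (List.ofFn fun a =>
            List.ofFn fun b => (((Φ a b).1 : ℕ), (Φ a b).2)))).getD v false) hseq hpost
  rw [div_le_iff₀ hpos]
  exact key

end SeqPostWindow

end Summit.PneNP.PneNP.Theorems
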